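/-
Copyright: the b2b-balaban T⁴-continuum CRUX team, row NE7b leaf lineage `t4-ne7b-formalise-leaf-06` (gen 152). Project licence.
-/
import Summits.QuantumFields.BalabanUV.T4Continuum.Spine.NE7b.HessianLocality

/-!
# THE HESSIAN OPERATOR NORM OF A SUM OF LOCAL TERMS IS INTENSIVE: `‖D²P(z)‖_op ≤ d·h` for `P = Σ_p Φ_p ∘ π_p` with coordinate
# readings `π_p` of bounded-overlap supports (`≤ d` per coordinate) and `‖D²Φ_p(π_p z)‖ ≤ h` per term, `Φ_p ∈ C²(U_p)` ONLY —
# the `‖D²P(x₀)‖` entering the reading road's modulus `2σ − (‖D²P(x₀)‖ + c·ρ)` (`…ConvexWindowSuppliersBox` §2–§3,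
# `…WindowHessianFromThirdDerivReading` §4) is bounded by LOCAL data, so with `…ThirdDerivLocalTerms` (`c = d·s²·τ`) EVERY number in
# that modulus is intensive (row NE7b, node U5c; letter (ℓ1) of the windowed road; [folklore] Cauchy–Schwarz + double counting)

Cell `pub-balaban`, sub-cell `t4`, spine estimate NE7b (`T4WeightBudget.RelWeightBound`; the cell's OWN estimate — NOT PRINTED in
[Bałaban 1983–89], NOT PROVED).  Crux-route work under `Spine/NE7b/` by a row leaf on the convexity road; NOTHING of Bałaban's is
named, valued or asserted; no `T4Continuum/Support` leaf typed; no `def`; zero `sorry`.  Import: the OWNER's BUILT `…HessianLocality` (the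
double-counting lemma `sum_sum_mem_le_of_boundedOverlap`, BY NAME) and, through it, Mathlib.

WHY.  `…HessianLocality` ∕ `…HessianLocalityCoord` bound the Hessian FORM of a bounded-overlap sum of local terms (`|D²P(x)[v,v]| ≤ h·d·‖v‖²`)
for GLOBALLY `C²` terms; the reading road's ENDs (`…ConvexWindowSuppliersBox.firstOrderOn_quadratic_add_of_thirdDeriv_reading`, its
`ContDiffOn` companion `…WindowHessianFromThirdDerivReading` §4–§5) display the OPERATOR norm `‖iteratedFDeriv ℝ 2 P x₀‖` at the window's
centre, and `…ThirdDerivLocalTerms` (this lineage) makes the other constant `c` intensive for `Φ_p ∈ C³(U_p)`.  THIS FILE closes the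
remaining extensive-looking number: by Cauchy–Schwarz over the terms and double counting over the supports, the operator norm of the Hessian
of a sum of coordinate-local terms at a point read into every `U_p` is at most `d·h` — `n` and the number of terms do not enter — with
`Φ_p ∈ C²(U_p)` only (the `k = 2` instance of `…ThirdDerivLocalTerms` §1–§2, re-derived INLINE as `have`s because that module has no hub
olean yet; nothing of it is restated as a declaration).

WHAT IS PROVED ([folklore]; `E = EuclideanSpace ℝ (Fin n)`, `𝔓` finite, supports `S_p ⊆ Fin n`, coordinate readings
`π_p : E →L[ℝ] EuclideanSpace ℝ (S_p)` with `(π_p v)_i = v_i` (`i ∈ S_p`), every coordinate in at most `d` supports):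
* §1 `sum_norm_sq_coordReading_le_of_overlap` (`Σ_p ‖π_p w‖² ≤ d·‖w‖²` — stated with the overlap count as the only input; the tree's
  `…HessianLocalityCoord.sum_norm_sq_coordReading_le` is the same fact in a module without hub olean, so it is re-derived from
  `…HessianLocality.sum_sum_mem_le_of_boundedOverlap` in a different binder shape), **`sum_norm_mul_norm_coordReading_le`**
  (`Σ_p ‖π_p u‖·‖π_p v‖ ≤ d·‖u‖·‖v‖`, Cauchy–Schwarz).
* §2 **`abs_iteratedFDeriv_two_localTerms_le`** — `U_p` open, `Φ_p ∈ C²(U_p)`, `π_p z ∈ U_p`, `‖D²Φ_p(π_p z)‖ ≤ h_p ≤ h`, `0 ≤ h` ⟹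
  `|D²P(z)[m₀, m₁]| ≤ (d·h)·‖m₀‖·‖m₁‖` for `P = Σ_p Φ_p ∘ π_p`.
* §3 **`norm_iteratedFDeriv_two_localTerms_le`** (`‖D²P(z)‖ ≤ d·h`) and the form corollaries `hessian_lower_of_localTermsOn` ∕
  `hessian_upper_of_localTermsOn` (`∓(d·h)‖v‖² ≶ D²P(z)[v,v]`) — the `ContDiffOn` version of `…HessianLocality`'s form bounds, any point `z`
  read into the `U_p`.
* §4 toy (kernel): the empty family (`𝔓 = Fin 0`): `P = 0`, `‖D²P(z)‖ ≤ d·h` for every `d, h ≥ 0` (`example`).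

NOT HERE (honest): the per-term `h_p` (the analytic supplier `…AnalyticGradientLetter.norm_iteratedFDeriv_two_chart_le` = `4M_p∕δ_p²`, retry
lane — one `exact` when its olean exists), the numbers `d, h`, the supports and WHICH `P` of Bałaban's ((A3) ∕ (A1c), NC-NE7b-α UNRULED), the
junction with `…WindowHessianFromThirdDerivReading` §4 (modulus `2σ − d(h + s²τ·a)` on `L ∩ box(x₀, a)` — one `exact` + `linarith`, certificate
owed when the oleans exist), block readings; anything of Bałaban's.  BY-NAME EFFECT ON THE WALL: NONE.  NE7b NOT PRINTED ∕ NOT PROVED; spine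
PROVED 0∕9; rung (B)+1 on a FINITE torus — NOT infinite volume, NOT the mass gap, NOT Clay.
HONEST DEPENDENCY: continuum YM on T⁴ ⇐ BetaPertH ∧ nine spine estimates (0/9 proved); BetaPertH ⇐ (D1) ∧ (D4) ∧ CAP+tail; G-an2-4 gates asym,
D1 and NE2∕3∕4.
-/

set_option autoImplicit false

noncomputable section

open Set Finset
open Summit.QuantumFields.BalabanUV.T4Continuum.NE7b.HessianLocality

namespace Summit.QuantumFields.BalabanUV.T4Continuum.NE7b.LocalTermsHessianNorm

variable {n : ℕ} {𝔓 : Type*} [Fintype 𝔓]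

/-! ## §1 Coordinate readings of bounded-overlap supports: `Σ_p ‖π_p u‖‖π_p v‖ ≤ d‖u‖‖v‖` -/

/-- **OVERLAP LETTER, SQUARED**: `(π_p v)_i = v_i` on `S_p` and every coordinate in at most `d` supports ⟹ `Σ_p ‖π_p w‖² ≤ d·‖w‖²`
(`‖π_p w‖² = Σ_{i ∈ S_p} w_i²`, then `…HessianLocality.sum_sum_mem_le_of_boundedOverlap`). [folklore] -/
theorem sum_norm_sq_coordReading_le_of_overlap (S : 𝔓 → Finset (Fin n))
    (π : (p : 𝔓) → (EuclideanSpace ℝ (Fin n) →L[ℝ] EuclideanSpace ℝ (S p)))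
    (hπ : ∀ p (v : EuclideanSpace ℝ (Fin n)) (i : S p), π p v i = v i) {d : ℕ}
    (hd : ∀ i : Fin n, (univ.filter fun p => i ∈ S p).card ≤ d) (w : EuclideanSpace ℝ (Fin n)) :
    ∑ p, ‖π p w‖ ^ 2 ≤ (d : ℝ) * ‖w‖ ^ 2 := by
  have h1 : ∀ p, ‖π p w‖ ^ 2 = ∑ i ∈ S p, w i ^ 2 := fun p => by
    rw [EuclideanSpace.real_norm_sq_eq, ← Finset.sum_coe_sort (S p) (fun i => w i ^ 2)]
    exact Finset.sum_congr rfl fun i _ => by rw [hπ p w i]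
  simp_rw [h1]
  rw [EuclideanSpace.real_norm_sq_eq w]
  exact sum_sum_mem_le_of_boundedOverlap S hd fun i => sq_nonneg _

/-- **OVERLAP LETTER, BILINEAR** (Cauchy–Schwarz over the terms): `Σ_p ‖π_p u‖·‖π_p v‖ ≤ d·‖u‖·‖v‖`. [folklore] -/
theorem sum_norm_mul_norm_coordReading_le (S : 𝔓 → Finset (Fin n))
    (π : (p : 𝔓) → (EuclideanSpace ℝ (Fin n) →L[ℝ] EuclideanSpace ℝ (S p)))
    (hπ : ∀ p (v : EuclideanSpace ℝ (Fin n)) (i : S p), π p v i = v i) {d : ℕ}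
    (hd : ∀ i : Fin n, (univ.filter fun p => i ∈ S p).card ≤ d) (u v : EuclideanSpace ℝ (Fin n)) :
    ∑ p, ‖π p u‖ * ‖π p v‖ ≤ (d : ℝ) * ‖u‖ * ‖v‖ := by
  have hu := sum_norm_sq_coordReading_le_of_overlap S π hπ hd u
  have hv := sum_norm_sq_coordReading_le_of_overlap S π hπ hd v
  have hcs : (∑ p, ‖π p u‖ * ‖π p v‖) ^ 2 ≤ (∑ p, ‖π p u‖ ^ 2) * ∑ p, ‖π p v‖ ^ 2 :=
    Finset.sum_mul_sq_le_sq_mul_sq univ (fun p => ‖π p u‖) fun p => ‖π p v‖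
  have h0 : 0 ≤ ∑ p, ‖π p u‖ * ‖π p v‖ := Finset.sum_nonneg fun p _ => by positivity
  have h2 : (∑ p, ‖π p u‖ * ‖π p v‖) ^ 2 ≤ ((d : ℝ) * ‖u‖ * ‖v‖) ^ 2 := by
    calc (∑ p, ‖π p u‖ * ‖π p v‖) ^ 2 ≤ (∑ p, ‖π p u‖ ^ 2) * ∑ p, ‖π p v‖ ^ 2 := hcs
      _ ≤ ((d : ℝ) * ‖u‖ ^ 2) * ((d : ℝ) * ‖v‖ ^ 2) :=
          mul_le_mul hu hv (Finset.sum_nonneg fun p _ => sq_nonneg _) (by positivity)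
      _ = ((d : ℝ) * ‖u‖ * ‖v‖) ^ 2 := by ring
  exact (pow_le_pow_iff_left₀ h0 (by positivity) two_ne_zero).1 h2

/-! ## §2 The Hessian entry of a sum of coordinate-local `C²(U_p)` terms -/

/-- **THE HESSIAN ENTRY OF A SUM OF LOCAL TERMS IS INTENSIVE.**  `P = Σ_p Φ_p ∘ π_p` with coordinate readings of bounded-overlap supports,
`U_p` open, `Φ_p ∈ C²(U_p)`, `π_p z ∈ U_p`, `‖D²Φ_p(π_p z)‖ ≤ h_p ≤ h` (`0 ≤ h`) ⟹ `|D²P(z)[m₀, m₁]| ≤ (d·h)·‖m₀‖·‖m₁‖`: the entry is the sum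
of the terms' entries read through `π_p` (Mathlib `iteratedFDeriv_fun_sum_apply` AT `z` + `iteratedFDerivWithin_comp_right` on the open
preimages — the `k = 2` case of `…ThirdDerivLocalTerms` §1–§2, inlined), each `≤ h·‖π_p m₀‖·‖π_p m₁‖`, and §1. [folklore] -/
theorem abs_iteratedFDeriv_two_localTerms_le (S : 𝔓 → Finset (Fin n))
    (π : (p : 𝔓) → (EuclideanSpace ℝ (Fin n) →L[ℝ] EuclideanSpace ℝ (S p)))
    (hπ : ∀ p (v : EuclideanSpace ℝ (Fin n)) (i : S p), π p v i = v i) {d : ℕ}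
    (hd : ∀ i : Fin n, (univ.filter fun p => i ∈ S p).card ≤ d) (Φ : (p : 𝔓) → EuclideanSpace ℝ (S p) → ℝ)
    (U : (p : 𝔓) → Set (EuclideanSpace ℝ (S p))) (hU : ∀ p, IsOpen (U p)) (hΦ : ∀ p, ContDiffOn ℝ 2 (Φ p) (U p))
    {z : EuclideanSpace ℝ (Fin n)} (hz : ∀ p, π p z ∈ U p) (hterm : 𝔓 → ℝ) {h : ℝ} (hh0 : 0 ≤ h) (hle : ∀ p, hterm p ≤ h)
    (hH : ∀ p, ‖iteratedFDeriv ℝ 2 (Φ p) (π p z)‖ ≤ hterm p) (m : Fin 2 → EuclideanSpace ℝ (Fin n)) :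
    |iteratedFDeriv ℝ 2 (fun x => ∑ p, Φ p (π p x)) z m| ≤ (d : ℝ) * h * ‖m 0‖ * ‖m 1‖ := by
  -- the `k = 2` table of the sum is the sum of the read tables
  have hcomp : ∀ p, iteratedFDeriv ℝ 2 (Φ p ∘ π p) z m = iteratedFDeriv ℝ 2 (Φ p) (π p z) (fun s => π p (m s)) := by
    intro p
    have hLo : IsOpen (π p ⁻¹' U p) := (hU p).preimage (π p).continuous
    have e1 : iteratedFDeriv ℝ 2 (Φ p ∘ π p) z = iteratedFDerivWithin ℝ 2 (Φ p ∘ π p) (π p ⁻¹' U p) z :=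
      (iteratedFDerivWithin_of_isOpen 2 hLo (hz p)).symm
    have e2 := (π p).iteratedFDerivWithin_comp_right (hΦ p) (hU p).uniqueDiffOn hLo.uniqueDiffOn (hz p) (i := 2) le_rfl
    have e3 : iteratedFDerivWithin ℝ 2 (Φ p) (U p) (π p z) = iteratedFDeriv ℝ 2 (Φ p) (π p z) :=
      iteratedFDerivWithin_of_isOpen 2 (hU p) (hz p)
    rw [e1, e2, ContinuousMultilinearMap.compContinuousLinearMap_apply, e3]
  have hat : ∀ p ∈ (univ : Finset 𝔓), ContDiffAt ℝ 2 (fun x => Φ p (π p x)) z :=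
    fun p _ => ((hΦ p).contDiffAt ((hU p).mem_nhds (hz p))).comp z (π p).contDiff.contDiffAt
  have hsum : iteratedFDeriv ℝ 2 (fun x => ∑ p, Φ p (π p x)) z m
      = ∑ p, iteratedFDeriv ℝ 2 (Φ p) (π p z) (fun s => π p (m s)) := by
    rw [iteratedFDeriv_fun_sum_apply hat, _root_.sum_apply]
    exact Finset.sum_congr rfl fun p _ => hcomp p
  rw [hsum]
  refine (Finset.abs_sum_le_sum_abs _ _).trans ?_
  -- each term `≤ h · ‖π_p m₀‖ · ‖π_p m₁‖`
  have hterm_le : ∀ p, |iteratedFDeriv ℝ 2 (Φ p) (π p z) (fun s => π p (m s))| ≤ h * (‖π p (m 0)‖ * ‖π p (m 1)‖) := by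
    intro p
    have hop := (iteratedFDeriv ℝ 2 (Φ p) (π p z)).le_opNorm (fun s => π p (m s))
    rw [Fin.prod_univ_two, Real.norm_eq_abs] at hop
    exact hop.trans (mul_le_mul_of_nonneg_right ((hH p).trans (hle p)) (by positivity))
  calc ∑ p, |iteratedFDeriv ℝ 2 (Φ p) (π p z) (fun s => π p (m s))| ≤ ∑ p, h * (‖π p (m 0)‖ * ‖π p (m 1)‖) :=
        Finset.sum_le_sum fun p _ => hterm_le p
    _ = h * ∑ p, ‖π p (m 0)‖ * ‖π p (m 1)‖ := by rw [Finset.mul_sum]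
    _ ≤ h * ((d : ℝ) * ‖m 0‖ * ‖m 1‖) :=
        mul_le_mul_of_nonneg_left (sum_norm_mul_norm_coordReading_le S π hπ hd (m 0) (m 1)) hh0
    _ = (d : ℝ) * h * ‖m 0‖ * ‖m 1‖ := by ring

/-! ## §3 The operator norm and the form bounds -/

/-- **`‖D²P(z)‖ ≤ d·h`** — the Hessian operator norm of a sum of coordinate-local `C²(U_p)` terms at a point read into every `U_p` is
bounded by the overlap `d` times the largest per-term Hessian norm `h`: INTENSIVE (no `n`, no number of terms). [folklore] -/
theorem norm_iteratedFDeriv_two_localTerms_le (S : 𝔓 → Finset (Fin n))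
    (π : (p : 𝔓) → (EuclideanSpace ℝ (Fin n) →L[ℝ] EuclideanSpace ℝ (S p)))
    (hπ : ∀ p (v : EuclideanSpace ℝ (Fin n)) (i : S p), π p v i = v i) {d : ℕ}
    (hd : ∀ i : Fin n, (univ.filter fun p => i ∈ S p).card ≤ d) (Φ : (p : 𝔓) → EuclideanSpace ℝ (S p) → ℝ)
    (U : (p : 𝔓) → Set (EuclideanSpace ℝ (S p))) (hU : ∀ p, IsOpen (U p)) (hΦ : ∀ p, ContDiffOn ℝ 2 (Φ p) (U p))
    {z : EuclideanSpace ℝ (Fin n)} (hz : ∀ p, π p z ∈ U p) (hterm : 𝔓 → ℝ) {h : ℝ} (hh0 : 0 ≤ h) (hle : ∀ p, hterm p ≤ h)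
    (hH : ∀ p, ‖iteratedFDeriv ℝ 2 (Φ p) (π p z)‖ ≤ hterm p) :
    ‖iteratedFDeriv ℝ 2 (fun x => ∑ p, Φ p (π p x)) z‖ ≤ (d : ℝ) * h := by
  refine ContinuousMultilinearMap.opNorm_le_bound (by positivity) fun m => ?_
  rw [Fin.prod_univ_two, Real.norm_eq_abs]
  calc |iteratedFDeriv ℝ 2 (fun x => ∑ p, Φ p (π p x)) z m| ≤ (d : ℝ) * h * ‖m 0‖ * ‖m 1‖ :=
        abs_iteratedFDeriv_two_localTerms_le S π hπ hd Φ U hU hΦ hz hterm hh0 hle hH m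
    _ = (d : ℝ) * h * (‖m 0‖ * ‖m 1‖) := by ring

/-- **FORM LOWER BOUND ON `U`**: `−(d·h)‖v‖² ≤ D²P(z)[v,v]` — `…HessianLocality.hessianOn_lower_of_boundedOverlap`'s shape with
`Φ_p ∈ C²(U_p)` only. [folklore] -/
theorem hessian_lower_of_localTermsOn (S : 𝔓 → Finset (Fin n))
    (π : (p : 𝔓) → (EuclideanSpace ℝ (Fin n) →L[ℝ] EuclideanSpace ℝ (S p)))
    (hπ : ∀ p (v : EuclideanSpace ℝ (Fin n)) (i : S p), π p v i = v i) {d : ℕ}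
    (hd : ∀ i : Fin n, (univ.filter fun p => i ∈ S p).card ≤ d) (Φ : (p : 𝔓) → EuclideanSpace ℝ (S p) → ℝ)
    (U : (p : 𝔓) → Set (EuclideanSpace ℝ (S p))) (hU : ∀ p, IsOpen (U p)) (hΦ : ∀ p, ContDiffOn ℝ 2 (Φ p) (U p))
    {z : EuclideanSpace ℝ (Fin n)} (hz : ∀ p, π p z ∈ U p) (hterm : 𝔓 → ℝ) {h : ℝ} (hh0 : 0 ≤ h) (hle : ∀ p, hterm p ≤ h)
    (hH : ∀ p, ‖iteratedFDeriv ℝ 2 (Φ p) (π p z)‖ ≤ hterm p) (v : EuclideanSpace ℝ (Fin n)) :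
    -((d : ℝ) * h) * ‖v‖ ^ 2 ≤ iteratedFDeriv ℝ 2 (fun x => ∑ p, Φ p (π p x)) z ![v, v] := by
  have habs := abs_iteratedFDeriv_two_localTerms_le S π hπ hd Φ U hU hΦ hz hterm hh0 hle hH ![v, v]
  simp only [Matrix.cons_val_zero, Matrix.cons_val_one] at habs
  have hl := (abs_le.1 habs).1
  nlinarith [hl]

/-- **FORM UPPER BOUND ON `U`**: `D²P(z)[v,v] ≤ (d·h)‖v‖²`. [folklore] -/
theorem hessian_upper_of_localTermsOn (S : 𝔓 → Finset (Fin n))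
    (π : (p : 𝔓) → (EuclideanSpace ℝ (Fin n) →L[ℝ] EuclideanSpace ℝ (S p)))
    (hπ : ∀ p (v : EuclideanSpace ℝ (Fin n)) (i : S p), π p v i = v i) {d : ℕ}
    (hd : ∀ i : Fin n, (univ.filter fun p => i ∈ S p).card ≤ d) (Φ : (p : 𝔓) → EuclideanSpace ℝ (S p) → ℝ)
    (U : (p : 𝔓) → Set (EuclideanSpace ℝ (S p))) (hU : ∀ p, IsOpen (U p)) (hΦ : ∀ p, ContDiffOn ℝ 2 (Φ p) (U p))
    {z : EuclideanSpace ℝ (Fin n)} (hz : ∀ p, π p z ∈ U p) (hterm : 𝔓 → ℝ) {h : ℝ} (hh0 : 0 ≤ h) (hle : ∀ p, hterm p ≤ h)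
    (hH : ∀ p, ‖iteratedFDeriv ℝ 2 (Φ p) (π p z)‖ ≤ hterm p) (v : EuclideanSpace ℝ (Fin n)) :
    iteratedFDeriv ℝ 2 (fun x => ∑ p, Φ p (π p x)) z ![v, v] ≤ (d : ℝ) * h * ‖v‖ ^ 2 := by
  have habs := abs_iteratedFDeriv_two_localTerms_le S π hπ hd Φ U hU hΦ hz hterm hh0 hle hH ![v, v]
  simp only [Matrix.cons_val_zero, Matrix.cons_val_one] at habs
  have hu := (abs_le.1 habs).2
  nlinarith [hu]

/-! ## §4 Toy check (kernel): the empty family — `P = 0`, and the bound `d·h` holds for every `d`, `h ≥ 0` -/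

example {n : ℕ} (d : ℕ) {h : ℝ} (hh0 : 0 ≤ h) (z : EuclideanSpace ℝ (Fin n)) :
    ‖iteratedFDeriv ℝ 2 (fun _ : EuclideanSpace ℝ (Fin n) => ∑ _ : Fin 0, (0 : ℝ)) z‖ ≤ (d : ℝ) * h :=
  norm_iteratedFDeriv_two_localTerms_le (𝔓 := Fin 0) (fun _ => (∅ : Finset (Fin n)))
    (fun _ => (0 : EuclideanSpace ℝ (Fin n) →L[ℝ] EuclideanSpace ℝ (∅ : Finset (Fin n)))) (fun p => p.elim0) (d := d)
    (fun i => by simp) (fun _ _ => 0) (fun _ => univ) (fun _ => isOpen_univ) (fun _ => contDiffOn_const)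
    (fun _ => mem_univ _) (fun _ => 0) hh0 (fun _ => hh0) (fun p => p.elim0)

end Summit.QuantumFields.BalabanUV.T4Continuum.NE7b.LocalTermsHessianNorm

end
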